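import Mathlib.CategoryTheory.Limits.Shapes.BinaryProducts
import Literature.AnabelianGeometry.SemiGraphs.BTempCechToolkit
import HarnessLib

/-!
# Semi-graphs of anabelioids, Appendix: the Čech cofork `A ⨯ (A ⨯ X) ⇉ A ⨯ X → X` is a coequalizer in
# `B^temp(Π)` (parallel convention `A ⨯ X`)

Mochizuki, *Semi-graphs of anabelioids*, Publ. RIMS **42** (2006), Appendix, proof of Theorem A.4
(manuscript pp. 85–86) [cite: MochizukiSemiAnbd2006, Thm A.4 proof pp.85-86].  PROOF-ONLY file (no
definitions): for the model temperoid `B^temp(Π)` (`Π` any topological group; abstract binary products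
`A ⨯ X`) and `A` with a point, `A ⨯ X → X` is the coequalizer of the Čech pair
`q₁ = pr₂ : A ⨯ (A ⨯ X) → A ⨯ X`, `q₂ = A ⨯ pr₂` (`BTemp.nonempty_isColimit_cechCofork`: the
augmentation is surjective on points, and an arrow coequalising the pair depends on the `X`-coordinate
only since `(a, x) = q₁(b, (a, x))`, `(b, x) = q₂(b, (a, x))`).  This is the input "`λ₂ ⋙ ψ^* ≅ K`" of
the Čech-extension proof of Thm. A.4 (row A4-∃; `QuasiTemperoidsThmA4CechQuotient.lean`); it is the
`A`-on-the-left twin of `BTemp.nonempty_isColimit_cofork_of_isLimit` (`QuasiTemperoidsThmA4Unique.lean`,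
kernel-pair form) and of abc-iut-w5-d220's `BTempCechNerve.lean` (convention `X ⨯ A`).  Points of
products via abc-iut-w4-d081's `BTempCechToolkit.lean`.  No side is taken on any disputed claim.
-/

open CategoryTheory CategoryTheory.Limits

namespace Literature.AnabelianGeometry.SemiGraphs

universe u

namespace BTemp

open Literature.AlgebraicGeometry.Frobenioids.QuasiTemperoid.BTempConnected (hom_ρ hom_ext_apply)

variable {G : Type u} [Group G] [TopologicalSpace G] [HasBinaryProducts (BTemp G)]

/-! ### The Čech cofork `A ⨯ (A ⨯ X) ⇉ A ⨯ X → X` is a coequalizer in `B^temp(Π)` -/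

section CechCofork

/-- Point-level first projection of `prod.map f g`. [cite: MochizukiSemiAnbd2006, Def 3.1(iii) p.33] -/
theorem prodMap_apply_fst {W X Y Z : BTemp G} (f : W ⟶ Y) (g : X ⟶ Z) (p : (W ⨯ X).obj.V) :
    ((prod.fst : Y ⨯ Z ⟶ Y).hom.hom ((prod.map f g).hom.hom p) : Y.obj.V) =
      f.hom.hom ((prod.fst : W ⨯ X ⟶ W).hom.hom p) :=
  congrArg (fun χ : W ⨯ X ⟶ Y => (χ.hom.hom p : Y.obj.V)) (prod.map_fst f g)

/-- Point-level second projection of `prod.map f g`. [cite: MochizukiSemiAnbd2006, Def 3.1(iii) p.33] -/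
theorem prodMap_apply_snd {W X Y Z : BTemp G} (f : W ⟶ Y) (g : X ⟶ Z) (p : (W ⨯ X).obj.V) :
    ((prod.snd : Y ⨯ Z ⟶ Z).hom.hom ((prod.map f g).hom.hom p) : Z.obj.V) =
      g.hom.hom ((prod.snd : W ⨯ X ⟶ X).hom.hom p) :=
  congrArg (fun χ : W ⨯ X ⟶ Z => (χ.hom.hom p : Z.obj.V)) (prod.map_snd f g)

/-- **In `B^temp(Π)`, for `A` with a point, `A ⨯ X → X` is the coequalizer of the Čech pair
`q₁, q₂ : A ⨯ (A ⨯ X) ⇉ A ⨯ X`** (`A ⨯ X → X` is surjective on points and an arrow out of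
`A ⨯ X` coequalising `q₁, q₂` only depends on the `X`-coordinate: `(a, x) = q₁(b,(a,x))`,
`(b, x) = q₂(b,(a,x))`). This is the presentation of an arbitrary object of `T` by objects of
`T[A]` in the proof of Thm. A.4. [cite: MochizukiSemiAnbd2006, Thm A.4 proof pp.85-86] -/
theorem nonempty_isColimit_cechCofork (A X : BTemp G) (a₀ : A.obj.V) :
    Nonempty (IsColimit (Cofork.ofπ (prod.snd : A ⨯ X ⟶ X)
      (by simp : (prod.snd : A ⨯ (A ⨯ X) ⟶ A ⨯ X) ≫ prod.snd =
        prod.map (𝟙 A) prod.snd ≫ prod.snd))) := by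
  classical
  -- points of `A ⨯ X` with prescribed coordinates
  have hpt : ∀ (a : A.obj.V) (x : X.obj.V), ∃ p : (A ⨯ X).obj.V,
      ((prod.fst : A ⨯ X ⟶ A).hom.hom p : A.obj.V) = a ∧ ((prod.snd : A ⨯ X ⟶ X).hom.hom p : X.obj.V) = x :=
    fun a x => exists_point_of_isLimit_binaryFan' (prodIsProd A X) a x
  choose pt hpt₁ hpt₂ using hpt
  -- an arrow coequalising the pair is constant on the fibres of `A ⨯ X → X`
  have hconst : ∀ (c : Cofork (prod.snd : A ⨯ (A ⨯ X) ⟶ A ⨯ X) (prod.map (𝟙 A) prod.snd))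
      (p p' : (A ⨯ X).obj.V),
      ((prod.snd : A ⨯ X ⟶ X).hom.hom p : X.obj.V) = (prod.snd : A ⨯ X ⟶ X).hom.hom p' →
      (c.π.hom.hom p : c.pt.obj.V) = c.π.hom.hom p' := by
    intro c p p' h
    obtain ⟨w, hw₁, hw₂⟩ := exists_point_of_isLimit_binaryFan' (prodIsProd A (A ⨯ X))
      ((prod.fst : A ⨯ X ⟶ A).hom.hom p') p
    have hq₂ : ((prod.map (𝟙 A) (prod.snd : A ⨯ X ⟶ X)).hom.hom w : (A ⨯ X).obj.V) = p' := by
      apply point_ext_of_isLimit_binaryFan (prodIsProd A X)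
      · rw [prodMap_apply_fst, hw₁]
        rfl
      · rw [prodMap_apply_snd, hw₂, h]
    have e := congrArg (fun χ : A ⨯ (A ⨯ X) ⟶ c.pt => (χ.hom.hom w : c.pt.obj.V)) c.condition
    change (c.π.hom.hom ((prod.snd : A ⨯ (A ⨯ X) ⟶ A ⨯ X).hom.hom w) : c.pt.obj.V) =
      c.π.hom.hom ((prod.map (𝟙 A) (prod.snd : A ⨯ X ⟶ X)).hom.hom w) at e
    rw [hw₂, hq₂] at e
    exact e
  refine ⟨Cofork.IsColimit.mk _
    (fun c => ObjectProperty.homMk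
      { hom := TypeCat.ofHom fun x : X.obj.V => (c.π.hom.hom (pt a₀ x) : c.pt.obj.V)
        comm := fun g => ?_ })
    (fun c => ?_) (fun c m hm => ?_)⟩
  · apply ConcreteCategory.hom_ext
    intro x
    change (c.π.hom.hom (pt a₀ (X.obj.ρ g x)) : c.pt.obj.V) = c.pt.obj.ρ g (c.π.hom.hom (pt a₀ x))
    rw [← hom_ρ c.π g (pt a₀ x)]
    apply hconst
    rw [hpt₂, hom_ρ prod.snd g (pt a₀ x), hpt₂]
  · apply hom_ext_apply
    intro p
    change (c.π.hom.hom (pt a₀ ((prod.snd : A ⨯ X ⟶ X).hom.hom p)) : c.pt.obj.V) = c.π.hom.hom p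
    exact hconst c _ _ (hpt₂ _ _)
  · apply hom_ext_apply
    intro x
    change (m.hom.hom x : c.pt.obj.V) = c.π.hom.hom (pt a₀ x)
    have hm' := congrArg (fun χ : A ⨯ X ⟶ c.pt => (χ.hom.hom (pt a₀ x) : c.pt.obj.V)) hm
    change (m.hom.hom ((prod.snd : A ⨯ X ⟶ X).hom.hom (pt a₀ x)) : c.pt.obj.V) = c.π.hom.hom (pt a₀ x) at hm'
    rwa [hpt₂] at hm'

end CechCofork

end BTemp

end Literature.AnabelianGeometry.SemiGraphs
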